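import Summits.BirchSwinnertonDyer.Rank1Residual.X5.KummerRelaxedStrictCount
import Summits.BirchSwinnertonDyer.Rank1Residual.X11b.KummerPoitouTateExact
import Literature.NumberTheory.EllipticCurves.QuadraticSelmerStructure
import HarnessLib

/-!
# Route `GenusKolyvaginAtTwo`, crux #2 `GenusPrimitiveSupplyAtTwo` (stmt-BirchSwinnertonDyer-22136):
# KRAMER PARITY VIA QUADRATIC SELMER STRUCTURES, part 1 — `𝔽₂` quadratic-form algebra, the local data of `E[n]`
# at EVERY place, and Poitou–Tate exactness for the Kummer structure over any number field (real places allowed)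

Width seat `bsd-line-gk2-p4` g11 (cell `bsd-f1-sign2`), F5-BRIDGE of the lead's (gk2-p1 g10) programme
«Poonen–Rains quadratic refinement at 2 ⟹ `MazurRubin2010.kramerParity_holds`». THEOREMS ONLY (no definition, no named
fact, no `sorry`); helper `--supports stmt-BirchSwinnertonDyer-22136`; no item is closed; BSD is not proved by any of this.

WHY. The UP half of Mazur–Rubin Cor. 3.4 (i) at `p = 2` (and with it the cell's T-A / T-V / T-C on the habitat and the twin
SUPPLY of this crux) is kernel-proved modulo ONE binder, Kramer's congruence `MazurRubin2010.kramerParity K` (Kramer 1981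
Thm. 1 = Mazur–Rubin 2010 Thm. 2.7). Its printed modern proof is Klagsbrun–Mazur–Rubin 2013 Thm. 3.9 (in the tree,
`QuadraticSelmerStructure.finrank_selmerGroup_sub_modEq`) applied to the Poonen–Rains Tate quadratic forms `q_v` on
`H¹(K_v, E[2])`. This series instantiates KMR Thm. 3.9 on the Kummer structure of `E[2]` and reduces `kramerParity K` to the
purely local/arithmetic content of Poonen–Rains §4 (the datum (Q1)–(Q4) of part 2), discharging every duality input
(Poitou–Tate with real places, Tate's local Euler characteristic, archimedean duality) from tree theorems. This file:

* §0 quadratic forms over `𝔽₂` from a function with bi-additive polarisation (`exists_quadraticForm_of_polar`, no definition),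
  Lagrangian criteria (`isLagrangian_of_annRight_eq`, `isLagrangian_of_isotropic_of_natCard_eq`), `relIndex_eq_two_pow`;
* §1 `H¹(K_v, E[n])` finite and `n`-torsion at every place; **the local Kummer condition is its own right annihilator under
  `inv_v(· ∪ₑ ·)` at EVERY place** (X5 `dualTransported_kummerSelmerStructure_eq`), and the left adjoint is injective at
  every place (finite: Tate; real: Milne I 2.13; complex: `H¹ = 0`);
* §2 **Poitou–Tate exactness for the Kummer structure WITHOUT the "totally complex" hypothesis of X11b
  `KummerPT.exists_mem_kummerOutside_localization_eq`**: `loc_{S'}(kummerOutside S')` is the exact annihilator of itself in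
  `⊕_{v∈S'} H¹(K_v, E[n])` for every number field `K` (real places through the injectivity of `inv_w`).

References: [KlagsbrunMazurRubin2013] Def. 2.1, Def. 3.3, Def. 3.8, Thm. 3.9 (arXiv:1111.2321 §2–§3); [MazurRubin2010]
Thm. 2.7, Lemma 2.9 (arXiv:0904.3709 pp. 7–8); [PoonenRains2012] Prop. 4.9–4.11, Thm. 4.14; [MilneADT2006] I Cor. 2.3,
Thm. 2.8, Thm. 2.13, Rem. 3.7, Cor. 3.4, Thm. 4.10 (b); [Howard2004HeegnerKolyvagin] Thm. 2.1.11.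
-/

set_option linter.dupNamespace false -- tree convention: `Summit.BirchSwinnertonDyer.BirchSwinnertonDyer.Theorems` (summit = sub-problem)
set_option autoImplicit false

noncomputable section

open scoped Classical ContRepresentation

namespace Summit.BirchSwinnertonDyer.BirchSwinnertonDyer.Theorems.GenusKolyKramer

open WeierstrassCurve Field NumberField IsDedekindDomain Function Module
open Literature.NumberTheory.EllipticCurves Literature.NumberTheory.GaloisRepresentations
open Literature.NumberTheory.GaloisRepresentations.DiscreteGaloisModule (SelmerStructure mu MuCarrier localTatePairingZMod tateDual)
open Literature.NumberTheory.GaloisCohomology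
open Literature.LinearAlgebra.QuadraticForm
open Summit.BirchSwinnertonDyer.Rank1Residual
open Summit.BirchSwinnertonDyer.Rank1Residual.X11b.FiniteDuality
open Summit.BirchSwinnertonDyer.Rank1Residual.X11b.Relaxation
open Summit.BirchSwinnertonDyer.Rank1Residual.X11b.LocBridge

/-! ## §0 Quadratic forms over `𝔽₂` from a function and its polar pairing -/

section Algebra

variable {V : Type*} [AddCommGroup V] [Module (ZMod 2) V]

/-- **A function `q : V → ℤ/2` whose polarisation `q(x+y) − q(x) − q(y)` is a bi-additive pairing `b` is a
quadratic form over `𝔽₂` with polar form `b`** (over `𝔽₂` the homogeneity `q(a x) = a² q(x)` is automatic: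
`a ∈ {0, 1}` and `q(0) = 0` by the polarisation identity). Existence form (no definition is introduced).
[cite: KlagsbrunMazurRubin2013, Def. 2.1 and Def. 3.2] -/
theorem exists_quadraticForm_of_polar (q : V → ZMod 2) (b : V →+ V →+ ZMod 2)
    (h : ∀ x y, q (x + y) = q x + q y + b x y) :
    ∃ Q : QuadraticForm (ZMod 2) V, (∀ x, Q x = q x) ∧ ∀ x y, polarForm Q x y = b x y := by
  have h0 : q 0 = 0 := by
    have h00 := h 0 0
    simp only [add_zero, map_zero] at h00
    have h2 : q 0 + q 0 = q 0 + 0 := by rw [add_zero]; exact h00.symm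
    exact add_left_cancel h2
  let B : LinearMap.BilinForm (ZMod 2) V :=
    LinearMap.mk₂ (ZMod 2) (fun x y => b x y)
      (fun x x' y => by rw [map_add, AddMonoidHom.add_apply])
      (fun c x y => by rw [ZMod.map_smul b c x, AddMonoidHom.smul_apply, smul_eq_mul])
      (fun x y y' => by rw [map_add])
      (fun c x y => by rw [ZMod.map_smul (b x) c y, smul_eq_mul])
  let Q : QuadraticForm (ZMod 2) V :=
    { toFun := q
      toFun_smul := fun a x => by
        obtain rfl | rfl : a = 0 ∨ a = 1 := by fin_cases a; exacts [Or.inl rfl, Or.inr rfl]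
        · rw [zero_smul, zero_mul, zero_smul, h0]
        · rw [one_smul, one_mul, one_smul]
      exists_companion' := ⟨B, fun x y => h x y⟩ }
  refine ⟨Q, fun x => rfl, fun x y => ?_⟩
  rw [polarForm_apply, QuadraticMap.polar]
  change q (x + y) - q x - q y = b x y
  rw [h x y]
  abel

variable (Q : QuadraticForm (ZMod 2) V) (b : V →+ V →+ ZMod 2) (hQb : ∀ x y, polarForm Q x y = b x y)
include hQb

/-- Nondegeneracy of the polar form from the injectivity of the left adjoint of `b`. [folklore] -/
theorem nondegenerate_of_injective (hb : Injective b) : (polarForm Q).Nondegenerate := by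
  rw [polarForm_nondegenerate_iff]
  intro x hx
  apply hb
  ext y
  rw [map_zero, AddMonoidHom.zero_apply, ← hQb, polarForm_apply]
  exact hx y

/-- **Lagrangian from "own right annihilator" + isotropy.** If a subgroup `X` is its own right annihilator
under the polar pairing `b` and `Q` vanishes on `X`, then `X` (as an `𝔽₂`-subspace) is Lagrangian.
[cite: KlagsbrunMazurRubin2013, Def. 2.1] -/
theorem isLagrangian_of_annRight_eq (X : AddSubgroup V) (hann : annRight b X = X) (hiso : ∀ x ∈ X, Q x = 0) :
    IsLagrangian Q (AddSubgroup.toZModSubmodule 2 X) := by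
  refine ⟨?_, fun x hx => hiso x hx⟩
  ext y
  rw [LinearMap.BilinForm.mem_orthogonal_iff]
  change (∀ x ∈ X, polarForm Q x y = 0) ↔ y ∈ X
  conv_rhs => rw [← hann]
  rw [mem_annRight_iff]
  refine forall₂_congr fun x _ => ?_
  rw [hQb]

omit hQb in
/-- Over `𝔽₂` a finite module has `Nat.card = 2 ^ finrank`. [folklore] -/
theorem natCard_eq_two_pow_finrank (X : Type*) [AddCommGroup X] [Module (ZMod 2) X] [Finite X] :
    Nat.card X = 2 ^ finrank (ZMod 2) X := by
  haveI : Module.Finite (ZMod 2) X := Module.Finite.of_finite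
  exact (Literature.GroupTheory.FiniteAbelian.pow_finrank_eq_natCard 2 X).symm

omit hQb in
/-- **Lagrangian from isotropy + the right order**: for a nondegenerate form, an isotropic subspace with the
same order as some Lagrangian subspace is Lagrangian. [cite: KlagsbrunMazurRubin2013, §2 (proof of Prop. 2.4)] -/
theorem isLagrangian_of_isotropic_of_natCard_eq [Finite V] (hnd : (polarForm Q).Nondegenerate)
    {X Y : Submodule (ZMod 2) V} (hY : IsLagrangian Q Y) (hX : IsTotallyIsotropic Q X)
    (hcard : Nat.card X = Nat.card Y) : IsLagrangian Q X := by
  haveI : Module.Finite (ZMod 2) V := Module.Finite.of_finite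
  refine isLagrangian_of_isTotallyIsotropic_of_two_mul_finrank_eq hnd hX ?_
  rw [← hY.two_mul_finrank hnd]
  congr 1
  have h1 := natCard_eq_two_pow_finrank X
  have h2 := natCard_eq_two_pow_finrank Y
  rw [hcard, h2] at h1
  exact (Nat.pow_right_injective le_rfl h1).symm

omit hQb in
/-- **A relative index in a finite `𝔽₂`-module is `2 ^ (dim X − dim (X ∩ A))`.** [folklore] -/
theorem relIndex_eq_two_pow [Finite V] (A X : AddSubgroup V) :
    A.relIndex X = 2 ^ (finrank (ZMod 2) (AddSubgroup.toZModSubmodule 2 X) -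
      finrank (ZMod 2) ↥(AddSubgroup.toZModSubmodule 2 X ⊓ AddSubgroup.toZModSubmodule 2 A)) := by
  have hinf : AddSubgroup.toZModSubmodule 2 X ⊓ AddSubgroup.toZModSubmodule 2 A =
      AddSubgroup.toZModSubmodule 2 (A ⊓ X) := by
    rw [← map_inf (AddSubgroup.toZModSubmodule 2) X A, inf_comm]
  rw [hinf, ← AddSubgroup.inf_relIndex_right A X]
  have hX : Nat.card (AddSubgroup.toZModSubmodule 2 X) = Nat.card X := rfl
  have hI : Nat.card (AddSubgroup.toZModSubmodule 2 (A ⊓ X)) = Nat.card ↥(A ⊓ X) := rfl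
  have h1 := natCard_eq_two_pow_finrank (AddSubgroup.toZModSubmodule 2 X)
  have h2 := natCard_eq_two_pow_finrank (AddSubgroup.toZModSubmodule 2 (A ⊓ X))
  rw [hX] at h1
  rw [hI] at h2
  -- `[X : A ⊓ X] · #(A ⊓ X) = #X`
  have hle : A ⊓ X ≤ X := inf_le_right
  have hmul : (A ⊓ X).relIndex X * Nat.card ↥(A ⊓ X) = Nat.card X := by
    rw [AddSubgroup.relIndex, mul_comm, ← Nat.card_congr (AddSubgroup.addSubgroupOfEquivOfLe hle).toEquiv]
    exact AddSubgroup.card_mul_index _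
  have hfle : finrank (ZMod 2) ↥(AddSubgroup.toZModSubmodule 2 (A ⊓ X)) ≤
      finrank (ZMod 2) ↥(AddSubgroup.toZModSubmodule 2 X) :=
    Submodule.finrank_mono ((AddSubgroup.toZModSubmodule 2).monotone hle)
  rw [h1, h2] at hmul
  have hpos : 0 < 2 ^ finrank (ZMod 2) ↥(AddSubgroup.toZModSubmodule 2 (A ⊓ X)) := pow_pos two_pos _
  refine Nat.eq_of_mul_eq_mul_right hpos ?_
  rw [hmul, ← pow_add, Nat.sub_add_cancel hfle]

end Algebra


/-! ## §1 The local data of `E[n]` at every place: finiteness, `n`-torsion, Kummer self-duality, perfectness -/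

section Local

variable {K : Type} [Field K] [NumberField K] (W : WeierstrassCurve K) [W.IsElliptic] (n : ℕ) [NeZero n]
variable (e : geomTorsion W n → geomTorsion W n → AlgebraicClosure K)
  (hμ : ∀ S T, e S T ^ n = 1)
  (hadd₁ : ∀ S₁ S₂ T, e (S₁ + S₂) T = e S₁ T * e S₂ T)
  (hadd₂ : ∀ S T₁ T₂, e S (T₁ + T₂) = e S T₁ * e S T₂)
  (hgal : ∀ (σ : absoluteGaloisGroup K) (S T : geomTorsion W n), σ • e S T = e (σ • S) (σ • T))
  (halt : ∀ T, e T T = 1) (hnondeg : ∀ T, (∀ S, e S T = 1) → T = 0)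
  (inv : LocalInvariants K n)

/-- `H¹(K_v, E[n])` is finite at every place `v` (finite `v`: Serre II.5.2; infinite `v`: `Γ_{K_v}` finite).
[cite: MilneADT2006, Ch. I, Cor. 2.3 and Thm. 2.13] -/
theorem finite_galoisCohomology_toLocal (v : Place K) :
    Finite (galoisCohomology ((W.torsionGaloisModule n).toLocal v) 1) := by
  haveI := finite_geomTorsion_of_neZero W n
  rcases v with w | v
  · haveI : Finite (absoluteGaloisGroup (Place.Completion (Sum.inl w : Place K))) :=
      finite_absoluteGaloisGroup_completion_infinitePlace w
    exact finite_galoisCohomology_one_of_finite_absoluteGaloisGroup _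
  · exact X11b.KummerPT.finite_galoisCohomology_toLocal_inr W n v

omit [NumberField K] [W.IsElliptic] [NeZero n] in
/-- `H¹(K, E[n])` is killed by `n`. [folklore] -/
theorem nsmul_galoisCohomology (x : galoisCohomology (W.torsionGaloisModule n) 1) : n • x = 0 :=
  galoisCohomology.nsmul_eq_zero_of_forall _ (fun T : geomTorsion W n => AddSubgroup.torsionBy.nsmul T) x

include halt hnondeg in
/-- **The local Kummer condition is its own right annihilator under `inv_v(· ∪ₑ ·)` at EVERY place** (`n` a
prime power; `inv` perfect at the finite places and injective at the real places; Tate's local Euler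
characteristic at the finite places): X5 `dualTransported_kummerSelmerStructure_eq` read through
`dualTransported_weilDual_eq_annRight`. [cite: MilneADT2006, Ch. I, Cor. 3.4, Thm. 2.13 and Rem. 3.7]
[cite: PoonenRains2012, Prop. 4.10] -/
theorem annRight_invWeilPairing_kummerSelmerStructure_eq (hn : IsPrimePow n) (hperf : inv.IsPerfect)
    (hEP : ∀ v : HeightOneSpectrum (𝓞 K), localEulerPoincareCharacteristic (v.adicCompletion K))
    (hreal : inv.InjectiveAtRealPlaces) (v : Place K) :
    annRight (invWeilPairing W n e hμ hadd₁ hadd₂ hgal inv v) (W.kummerSelmerStructure n v) =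
      W.kummerSelmerStructure n v := by
  haveI := finite_geomTorsion_of_neZero W n
  rw [← X5.SelfDualCount.dualTransported_weilDual_eq_annRight W n e hμ hadd₁ hadd₂ hgal inv]
  exact X5.SelfDualCount.dualTransported_kummerSelmerStructure_eq W n e hμ hadd₁ hadd₂ hgal halt
    hnondeg inv hn hperf hEP (fun w hw => hreal w hw) v

include halt hnondeg in
/-- **The left adjoint of `inv_v(· ∪ₑ ·)` on `H¹(K_v, E[n])` is injective at EVERY place** (finite `v`: Tate
local duality, `invWeilPairing_bijective`; real `w`: archimedean duality, `bijective_weilCupProduct_infinitePlace`,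
`inv_w` injective; complex `w`: `H¹(K_w, E[n]) = 0`). [cite: MilneADT2006, Ch. I, Cor. 2.3 and Thm. 2.13 (a)] -/
theorem invWeilPairing_injective (hperf : inv.IsPerfect) (hreal : inv.InjectiveAtRealPlaces) (v : Place K) :
    Injective (invWeilPairing W n e hμ hadd₁ hadd₂ hgal inv v) := by
  haveI := finite_geomTorsion_of_neZero W n
  rcases v with w | v
  · rcases w.isReal_or_isComplex with hw | hw
    · exact (bijective_weilCupProduct_infinitePlace W n e hμ hadd₁ hadd₂ w hgal halt hnondeg (inv (Sum.inl w))
        (hreal w hw) (invWeilPairing W n e hμ hadd₁ hadd₂ hgal inv (Sum.inl w))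
        (fun x y => invWeilPairing_apply W n e hμ hadd₁ hadd₂ hgal inv (Sum.inl w) x y)).1.1
    · haveI := subsingleton_galoisCohomology_toLocal_inl_of_isComplex
        (W.torsionGaloisModule n) hw
      exact fun x y _ => Subsingleton.elim x y
  · exact (invWeilPairing_bijective W n e hμ hadd₁ hadd₂ hgal hnondeg inv v (hperf v).1.1).1

end Local

/-! ## §2 Poitou–Tate exactness for the Kummer structure at a general number field (real places allowed) -/

section Exactness

variable {K : Type} [Field K] [NumberField K] (W : WeierstrassCurve K) [W.IsElliptic] (n : ℕ) [NeZero n]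
variable (e : geomTorsion W n → geomTorsion W n → AlgebraicClosure K)
  (hμ : ∀ S T, e S T ^ n = 1)
  (hadd₁ : ∀ S₁ S₂ T, e (S₁ + S₂) T = e S₁ T * e S₂ T)
  (hadd₂ : ∀ S T₁ T₂, e S (T₁ + T₂) = e S T₁ * e S T₂)
  (hgal : ∀ (σ : absoluteGaloisGroup K) (S T : geomTorsion W n), σ • e S T = e (σ • S) (σ • T))
  (halt : ∀ T, e T T = 1) (hnondeg : ∀ T, (∀ S, e S T = 1) → T = 0)
  (inv : LocalInvariants K n) [Finite (geomTorsion W n)]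

include halt hnondeg in
/-- **The Weil transport of a dual Selmer class for `(kummerStrict S')^*` lies in `kummerOutside W n S'`** —
X11b `KummerPT.map_weilDualInv_mem_kummerOutside_of_mem_dualSelmerGroup` WITHOUT the hypothesis that `K` be
totally complex: at a place `v ∉ S'` the dual condition `𝓚_v^*` transports into `𝓚_v` because the Kummer
structure is residually self-dual at EVERY place (X5 `dualTransported_kummerSelmerStructure_eq`, real places
by the injectivity of `inv_w`). [cite: MilneADT2006, Ch. I §6, proof of Prop. 6.9 and Thm. 2.13]
[cite: Howard2004HeegnerKolyvagin, Thm. 2.1.11 (arXiv:1202.6340 p. 6)] -/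
theorem map_weilDualInv_mem_kummerOutside_of_mem_dualSelmerGroup (hn : IsPrimePow n) (hperf : inv.IsPerfect)
    (hEP : ∀ v : HeightOneSpectrum (𝓞 K), localEulerPoincareCharacteristic (v.adicCompletion K))
    (hreal : inv.InjectiveAtRealPlaces) (S' : Finset (Place K))
    {y : galoisCohomology ((W.torsionGaloisModule n).tateDual n) 1}
    (hy : y ∈ (inv.dualSelmerStructure (W.torsionGaloisModule n) (X11b.KummerPT.kummerStrict W n S')).selmerGroup) :
    galoisCohomology.map (weilDualInv W n e hμ hadd₁ hadd₂ hgal hnondeg) 1 y ∈ kummerOutside W n S' := by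
  set yW := galoisCohomology.map (weilDualInv W n e hμ hadd₁ hadd₂ hgal hnondeg) 1 y with hyWdef
  have hwy : galoisCohomology.map (weilDualIntertwining W n e hμ hadd₁ hadd₂ hgal) 1 yW = y :=
    map_weilDual_map_weilDualInv W n e hμ hadd₁ hadd₂ hgal hnondeg y
  rw [mem_kummerOutside_iff]
  intro v hv
  have hyv := (SelmerStructure.mem_selmerGroup_iff _ y).mp hy v
  rw [LocalInvariants.dualSelmerStructure_apply, X11b.KummerPT.kummerStrict_of_not_mem W n S' hv] at hyv
  change galoisCohomology.localization (W.torsionGaloisModule (n : ℤ)) v 1 yW ∈ W.kummerSelmerStructure (n : ℤ) v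
  rw [← X5.SelfDualCount.dualTransported_kummerSelmerStructure_eq W n e hμ hadd₁ hadd₂ hgal halt
    hnondeg inv hn hperf hEP (fun w hw => hreal w hw) v, LocalInvariants.mem_dualTransported_iff]
  change galoisCohomology.map ((weilDualIntertwining W n e hμ hadd₁ hadd₂ hgal).restrictField (Place.Completion v)) 1
      (galoisCohomology.localization (W.torsionGaloisModule (n : ℤ)) v 1 yW) ∈ _
  rw [← X11b.Levels.localization_map_one, hwy, LocalInvariants.dualSelmerStructure_apply]
  exact hyv

include halt hnondeg in
/-- **POITOU–TATE EXACTNESS FOR THE KUMMER STRUCTURE, any number field** (Milne I Thm. 4.10 (b)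
`Ker γ¹ ⊆ Im β¹` at `⊕_{v∈S'} H¹(K_v, E[n])`, from the cited Howard Thm. 2.1.11 `SelmerComplement`): `n` a prime
power, `inv` a family with `IsPerfect`, `SelmerComplement`, injective at the real places, and Tate's local
Euler characteristic. If `t_v ∈ H¹(K_v, E[n])` (`v ∈ S'`) satisfies `∑_{v∈S'} inv_v(t_v ∪ₑ loc_v c) = 0` for every
`c ∈ kummerOutside W n S'`, then `t_v = loc_v x` on `S'` for some `x ∈ kummerOutside W n S'`. (X11b
`KummerPT.exists_mem_kummerOutside_localization_eq` with its "totally complex" hypothesis removed.)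
[cite: Howard2004HeegnerKolyvagin, Thm. 2.1.11 (arXiv:1202.6340 p. 6)] [cite: MilneADT2006, Ch. I, Thm. 4.10(b)] -/
theorem exists_mem_kummerOutside_localization_eq (hn : IsPrimePow n) (hperf : inv.IsPerfect)
    (hcompl : inv.SelmerComplement)
    (hEP : ∀ v : HeightOneSpectrum (𝓞 K), localEulerPoincareCharacteristic (v.adicCompletion K))
    (hreal : inv.InjectiveAtRealPlaces) (S' : Finset (Place K))
    (t : Π v : Place K, galoisCohomology ((W.torsionGaloisModule n).toLocal v) 1)
    (ht : ∀ c ∈ kummerOutside W n S',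
      ∑ v ∈ S', invWeilPairing W n e hμ hadd₁ hadd₂ hgal inv v (t v)
        (galoisCohomology.localization (W.torsionGaloisModule n) v 1 c) = 0) :
    ∃ x ∈ kummerOutside W n S', ∀ v ∈ S', galoisCohomology.localization (W.torsionGaloisModule n) v 1 x = t v := by
  classical
  obtain ⟨p, k, hp, hk, rfl⟩ := (isPrimePow_nat_iff n).mp hn
  haveI : Fact p.Prime := ⟨hp⟩
  obtain ⟨T, hS'T, hinf, hpT, hbad⟩ := X11b.KummerPT.exists_exceptional_finset W p S'
  have hMn : ∀ m : W.geomTorsion ((p ^ k : ℕ) : ℤ), (p ^ k) • m = 0 := fun m ↦ AddSubgroup.torsionBy.nsmul m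
  have hTout : ∀ v : HeightOneSpectrum (𝓞 K), (Sum.inr v : Place K) ∉ T →
      ((p ^ k : ℕ) : 𝓞 K) ∉ v.asIdeal ∧ GaloisRep.IsUnramifiedAt v (W.torsionGaloisModule ((p ^ k : ℕ) : ℤ)) := by
    intro v hv
    have hpv : ((p : ℕ) : 𝓞 K) ∉ v.asIdeal := fun h ↦ hv (hpT v h)
    have hgood : W.HasGoodReductionAt v := by
      by_contra hbad'
      exact hv (hbad v hbad')
    exact ⟨X11b.AcSelmer.natCast_pow_not_mem p hpv _,
      X11b.AcSelmer.isUnramifiedAt_torsionGaloisModule W hgood (X11b.AcSelmer.intCast_pow_not_mem p hpv _)⟩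
  -- the test family, extended by zero off `S'`
  set t' : Π v : Place K, galoisCohomology ((W.torsionGaloisModule ((p ^ k : ℕ) : ℤ)).toLocal v) 1 :=
    fun v ↦ if v ∈ S' then t v else 0 with ht'def
  have ht'mem : ∀ v ∈ S', t' v = t v := fun v hv ↦ by rw [ht'def]; exact if_pos hv
  have ht'not : ∀ v ∉ S', t' v = 0 := fun v hv ↦ by rw [ht'def]; exact if_neg hv
  have ht' : ∀ v ∈ T, t' v ∈ X11b.KummerPT.kummerRelaxed W (p ^ k) S' v := by
    intro v _
    by_cases hv : v ∈ S'
    · rw [X11b.KummerPT.kummerRelaxed_of_mem W (p ^ k) S' hv]; exact AddSubgroup.mem_top _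
    · rw [ht'not v hv]; exact zero_mem _
  obtain ⟨x, hx, hxt⟩ := (hcompl (W.torsionGaloisModule ((p ^ k : ℕ) : ℤ)) hMn T hTout
    (X11b.KummerPT.kummerStrict W (p ^ k) S') (X11b.KummerPT.kummerRelaxed W (p ^ k) S')
    (X11b.KummerPT.kummerStrict_le_kummerRelaxed W (p ^ k) S')
    (X11b.KummerPT.kummerStrict_isUnramifiedOutside W p k S' T hS'T hinf hpT hbad)
    (X11b.KummerPT.kummerRelaxed_isUnramifiedOutside W p k S' T hS'T hinf hpT hbad)).1 t' ht' (fun y hy ↦ by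
      set yW := galoisCohomology.map (weilDualInv W (p ^ k) e hμ hadd₁ hadd₂ hgal hnondeg) 1 y with hyWdef
      have hyW : galoisCohomology.map (weilDualIntertwining W (p ^ k) e hμ hadd₁ hadd₂ hgal) 1 yW = y :=
        map_weilDual_map_weilDualInv W (p ^ k) e hμ hadd₁ hadd₂ hgal hnondeg y
      have hyKO : yW ∈ kummerOutside W (p ^ k) S' :=
        map_weilDualInv_mem_kummerOutside_of_mem_dualSelmerGroup W (p ^ k) e hμ hadd₁ hadd₂ hgal halt hnondeg
          inv hn hperf hEP hreal S' hy
      have hterm : ∀ v : Place K,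
          localTatePairingZMod (W.torsionGaloisModule ((p ^ k : ℕ) : ℤ)) (p ^ k) v (inv v) (t' v)
            (galoisCohomology.localization ((W.torsionGaloisModule ((p ^ k : ℕ) : ℤ)).tateDual (p ^ k)) v 1 y) =
          invWeilPairing W (p ^ k) e hμ hadd₁ hadd₂ hgal inv v (t' v)
            (galoisCohomology.localization (W.torsionGaloisModule ((p ^ k : ℕ) : ℤ)) v 1 yW) := by
        intro v
        rw [← hyW, X11b.Levels.localization_map_one, localTatePairingZMod_map_weilDual, invWeilPairing_apply]
      calc ∑ v ∈ T, localTatePairingZMod (W.torsionGaloisModule ((p ^ k : ℕ) : ℤ)) (p ^ k) v (inv v)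
              (t' v) (galoisCohomology.localization ((W.torsionGaloisModule ((p ^ k : ℕ) : ℤ)).tateDual (p ^ k)) v 1 y)
          = ∑ v ∈ T, invWeilPairing W (p ^ k) e hμ hadd₁ hadd₂ hgal inv v (t' v)
              (galoisCohomology.localization (W.torsionGaloisModule ((p ^ k : ℕ) : ℤ)) v 1 yW) :=
            Finset.sum_congr rfl fun v _ ↦ hterm v
        _ = ∑ v ∈ S', invWeilPairing W (p ^ k) e hμ hadd₁ hadd₂ hgal inv v (t' v)
              (galoisCohomology.localization (W.torsionGaloisModule ((p ^ k : ℕ) : ℤ)) v 1 yW) := by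
            refine (Finset.sum_subset hS'T fun v _ hvS' ↦ ?_).symm
            rw [ht'not v hvS', map_zero, AddMonoidHom.zero_apply]
        _ = ∑ v ∈ S', invWeilPairing W (p ^ k) e hμ hadd₁ hadd₂ hgal inv v (t v)
              (galoisCohomology.localization (W.torsionGaloisModule ((p ^ k : ℕ) : ℤ)) v 1 yW) :=
            Finset.sum_congr rfl fun v hv ↦ by rw [ht'mem v hv]
        _ = 0 := ht yW hyKO)
  refine ⟨x, ?_, fun v hv ↦ ?_⟩
  · rw [← X11b.KummerPT.selmerGroup_kummerRelaxed W (p ^ k) S']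
    exact hx
  · have h := hxt v (hS'T hv)
    rw [X11b.KummerPT.kummerStrict_of_mem W (p ^ k) S' hv, AddSubgroup.mem_bot, sub_eq_zero, ht'mem v hv] at h
    exact h

end Exactness

end Summit.BirchSwinnertonDyer.BirchSwinnertonDyer.Theorems.GenusKolyKramer

end
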